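import Mathlib
import Summits.NavierStokesRegularity.NavierStokesRegularity.Theorems.EulerZoomLiouvillePowerGaugeEulerLiouvilleChiralAnchorRaceStep
import Summits.NavierStokesRegularity.NavierStokesRegularity.Theorems.EulerZoomLiouvillePowerGaugeEulerLiouvilleChiralAnchorRaceSums
import HarnessLib

/-!
# Crux `EulerZoomLiouville.PowerGaugeEulerLiouville` (stmt-NavierStokesRegularity-19832), width sub-line `chiral_anchor` (ns-idea-11 g10, REV3),
# stub K4 `stub_anchorRace` (THE RACE) — part (d): THE RACE ON A WINDOW

Seat ns-ezl-w3 g8 (`--supports stmt-NavierStokesRegularity-19832 --as helper`).  `ChiralAnchor.race_contradiction`: a classical Euler solution with the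
`A`-gauge (exponent `ρ > 0`, constant `c`) and the `E`-gauge read on the classical gradient, the shell helicity floor (constant `C`), the far-volume
bound along an anchor flow `X` of the label set `T = {χ ≠ 0} ⊆ B(0,R)` on the window `[t₀ − A², t₀]` (constant `C_V`), transported weights `χ'_r`
(`|χ'| ≤ 1`, `{χ'_r ≠ 0} ⊆ X_r(T)`) of CONSTANT weighted helicity `H₀ ≠ 0`, and a scale `A ≥ max(1, R, √|t₀|)` beating the exponent count
(`K₁A^{1−ρ} + K₂ + (K₃Σ₁ + K₄Σ₂)A^{2−2ρ} < A²`) — is absurd: at each time of the window a dyadic region hosts `|H₀|/((j+1)(j+2))` of the helicity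
(`exists_hosting`), pays the enstrophy quantum `e_j` (`ofReal_quantum_le_lintegral`), the `E`-gauge caps the hosting times (`measureReal_le_sum_of_cover`),
and the costs sum below `A²` (`coreTerm_le`, `shellTerm_le`).  Part (e) feeds the line's `InClass ∧ IsChiralTubePast ∧ HasAnchorFlows`.

HONEST FRAMING: one stub of a width sub-line of the MODEL-lattice crux class; the line's K6 (the crux's open complement) is untouched; nothing about
the crux E (19832 OPEN) or NS regularity; not E. [cite: Moffatt1969, §3; CaffarelliKohnNirenberg1982, §2]
-/

noncomputable section

set_option linter.dupNamespace false

open MeasureTheory Set Filter Topology Metric Function InnerProductSpace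
open scoped RealInnerProductSpace NNReal ENNReal ContDiff Topology

namespace Summit.NavierStokesRegularity.NavierStokesRegularity.Theorems.PowerGaugeEulerLiouville.ChiralAnchor

open Literature.Analysis Literature.Analysis.FluidPDE
open Summit.NavierStokesRegularity.NavierStokesRegularity.Theorems.PowerGaugeEulerLiouville

variable {u : ℝ → EuclideanSpace ℝ (Fin 3) → EuclideanSpace ℝ (Fin 3)} {p : ℝ → EuclideanSpace ℝ (Fin 3) → ℝ}

/-- ★ **THE RACE ON A WINDOW** (see the module docstring). [cite: Moffatt1969, §3; CaffarelliKohnNirenberg1982, §2] -/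
theorem race_contradiction {ρ : ℝ} (hρ : 0 < ρ) {c : ℝ≥0} (hcl : IsClassicalEulerSolutionOn (Iio 0) 0 u p)
    (hA : ∀ a : ℝ, 0 < a → ENNReal.ofReal (a ^ (2 * ρ)) * cknA a (0 : ℝ × EuclideanSpace ℝ (Fin 3)) u ≤ (c : ℝ≥0∞))
    (hEwin : ∀ a : ℝ, 0 < a → ∫⁻ z in Ioo (-a ^ 2) 0 ×ˢ ball (0 : EuclideanSpace ℝ (Fin 3)) a,
        ENNReal.ofReal (frobeniusNormSq (fderiv ℝ (u z.1) z.2)) ≤ ENNReal.ofReal ((c : ℝ) * a ^ (1 - ρ)))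
    {C : ℝ} (hC : 0 < C)
    (hF : ∀ R : ℝ, 0 < R → ∀ v : EuclideanSpace ℝ (Fin 3) → EuclideanSpace ℝ (Fin 3), ContDiff ℝ 1 v →
      ∀ w : EuclideanSpace ℝ (Fin 3) → ℝ, Measurable w → (∀ x : EuclideanSpace ℝ (Fin 3), |w x| ≤ 1) →
        ∀ T : Set (EuclideanSpace ℝ (Fin 3)), MeasurableSet T → volume T < ⊤ → (∀ x : EuclideanSpace ℝ (Fin 3), x ∉ T → w x = 0) →
          |∫ x in Metric.ball (0 : EuclideanSpace ℝ (Fin 3)) R, w x * inner ℝ (v x) (curl v x)| ≤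
            C * (volume T).toReal ^ (1 / 3 : ℝ) *
                (Real.sqrt (∫ x in Metric.ball (0 : EuclideanSpace ℝ (Fin 3)) R, ‖fderiv ℝ v x‖ ^ 2) +
                  R⁻¹ * Real.sqrt (∫ x in Metric.ball (0 : EuclideanSpace ℝ (Fin 3)) R, ‖v x‖ ^ 2)) *
              Real.sqrt (∫ x in Metric.ball (0 : EuclideanSpace ℝ (Fin 3)) R, ‖curl v x‖ ^ 2))
    {CV : ℝ} (hCV : 0 < CV) {t₀ : ℝ} (ht₀ : t₀ < 0)
    {χ : EuclideanSpace ℝ (Fin 3) → ℝ} (hχc : Continuous χ) {R : ℝ} (hχ0 : ∀ x, R ≤ ‖x‖ → χ x = 0)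
    {H₀ : ℝ} (hH₀ : H₀ ≠ 0) {A : ℝ} (hA1 : 1 ≤ A) (hAR : R ≤ A) (hAt : -t₀ ≤ A ^ 2)
    (hAlt : 8 * C * (‖curlCLM‖ + 1) * c * ((volume {x | χ x ≠ 0}).toReal + 1) ^ (1 / 3 : ℝ) / |H₀| * A ^ (1 - ρ) +
        16 * C ^ 2 * (‖curlCLM‖ + 1) ^ 2 * c * ((c : ℝ) + 1) * ((volume {x | χ x ≠ 0}).toReal + 1) ^ (2 / 3 : ℝ) / |H₀| ^ 2 +
        (64 * C * (‖curlCLM‖ + 1) * CV ^ 2 * (Real.sqrt c + 1) ^ 2 * c / |H₀| *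
              ∑' j : ℕ, ((j : ℝ) + 1) * ((j : ℝ) + 2) * ((2 : ℝ) ^ (-2 * ρ)) ^ j +
            1024 * C ^ 2 * (‖curlCLM‖ + 1) ^ 2 * CV ^ 4 * (Real.sqrt c + 1) ^ 4 * c * ((c : ℝ) + 1) / |H₀| ^ 2 *
              ∑' j : ℕ, (((j : ℝ) + 1) * ((j : ℝ) + 2)) ^ 2 * ((2 : ℝ) ^ (-2 - 2 * ρ)) ^ j) * A ^ (2 - 2 * ρ) < A ^ 2)
    {X : ℝ → EuclideanSpace ℝ (Fin 3) → EuclideanSpace ℝ (Fin 3)} (hXc : Continuous fun q : ℝ × EuclideanSpace ℝ (Fin 3) => X q.1 q.2)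
    (hXvol : ∀ r ∈ Icc (t₀ - A ^ 2) t₀, ∀ S ⊆ {x | χ x ≠ 0}, MeasurableSet S → MeasurableSet (X r '' S) ∧ volume (X r '' S) = volume S)
    {R' : ℝ} (hXball : ∀ r ∈ Icc (t₀ - A ^ 2) t₀, X r '' {x | χ x ≠ 0} ⊆ ball (0 : EuclideanSpace ℝ (Fin 3)) R')
    (hfar : ∀ Rf : ℝ, 2 * R ≤ Rf → -Rf ^ 2 < t₀ - A ^ 2 → ∀ s ∈ Icc (t₀ - A ^ 2) t₀, ∀ E₀ ⊆ {x | χ x ≠ 0}, MeasurableSet E₀ →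
      (∀ y ∈ E₀, Rf ≤ ‖X s y‖) →
        (volume E₀).toReal ^ (1 / 6 : ℝ) * (Rf - R) ≤
          CV * Real.sqrt (c : ℝ) * (Real.sqrt (t₀ - s) * Rf ^ ((1 - ρ) / 2) + (t₀ - s) * Rf ^ (-(1 / 2 + ρ))))
    {χ' : ℝ → EuclideanSpace ℝ (Fin 3) → ℝ} (hχ'c : ∀ r ∈ Icc (t₀ - A ^ 2) t₀, Continuous (χ' r))
    (hχ'1 : ∀ r ∈ Icc (t₀ - A ^ 2) t₀, ∀ x, |χ' r x| ≤ 1)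
    (hχ'supp : ∀ r ∈ Icc (t₀ - A ^ 2) t₀, ∀ x, χ' r x ≠ 0 → x ∈ X r '' {x | χ x ≠ 0})
    (hhel : ∀ r ∈ Icc (t₀ - A ^ 2) t₀, ∫ x, χ' r x * ⟪u r x, curl (u r) x⟫ = H₀) : False := by
  -- ### constants and the label set
  have hA0 : 0 < A := lt_of_lt_of_le one_pos hA1
  have hH : 0 < |H₀| := abs_pos.2 hH₀
  have hκ : 0 < ‖curlCLM‖ + 1 := by positivity
  have hc0 : 0 ≤ (c : ℝ) := c.2
  have hc₁ : 0 < (c : ℝ) + 1 := by positivity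
  have hs₁ : 0 < Real.sqrt c + 1 := by positivity
  have hTm : MeasurableSet ({x | χ x ≠ 0} : Set (EuclideanSpace ℝ (Fin 3))) :=
    (isOpen_ne_fun hχc continuous_const).measurableSet
  have hTball : ({x | χ x ≠ 0} : Set (EuclideanSpace ℝ (Fin 3))) ⊆ ball (0 : EuclideanSpace ℝ (Fin 3)) R := fun x hx => by
    rw [mem_ball_zero_iff]; by_contra h; exact hx (hχ0 x (not_lt.1 h))
  have hTfin : volume ({x | χ x ≠ 0} : Set (EuclideanSpace ℝ (Fin 3))) < ⊤ := (measure_mono hTball).trans_lt measure_ball_lt_top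
  have hv₁ : 0 < (volume ({x | χ x ≠ 0} : Set (EuclideanSpace ℝ (Fin 3)))).toReal + 1 := by positivity
  -- geometric ratios
  have hx0 : 0 ≤ (2 : ℝ) ^ (-2 * ρ) := Real.rpow_nonneg (by norm_num) _
  have hx1 : (2 : ℝ) ^ (-2 * ρ) < 1 := Real.rpow_lt_one_of_one_lt_of_neg one_lt_two (by linarith)
  have hz0 : 0 ≤ (2 : ℝ) ^ (-2 - 2 * ρ) := Real.rpow_nonneg (by norm_num) _
  have hz1 : (2 : ℝ) ^ (-2 - 2 * ρ) < 1 := Real.rpow_lt_one_of_one_lt_of_neg one_lt_two (by linarith)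
  have hS1 := (summable_weightSq_geometric hx0 hx1).1
  have hS2 := (summable_weightSq_geometric hz0 hz1).2
  -- ### the number of shells
  obtain ⟨N, hN⟩ := exists_nat_gt (R' / A)
  have hJball : R' ≤ 2 ^ (N + 1) * A := by
    have h1 : R' < N * A := by rwa [div_lt_iff₀ hA0] at hN
    have h2 : (N : ℝ) ≤ 2 ^ (N + 1) := by
      have := Nat.lt_two_pow_self (n := N + 1)
      exact_mod_cast (Nat.le_succ N).trans this.le
    nlinarith
  -- ### per-region data
  obtain ⟨Vbar, hVbar⟩ : ∃ Vbar : ℕ → ℝ, ∀ j, Vbar j = if j = 0 then (volume ({x | χ x ≠ 0} : Set (EuclideanSpace ℝ (Fin 3)))).toReal + 1 else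
      (4 * CV * (Real.sqrt c + 1) * (2 ^ j * A) ^ ((1 - ρ) / 2) * (2 ^ j)⁻¹) ^ 6 := ⟨_, fun j => rfl⟩
  have hVbar_pos : ∀ j, 0 < Vbar j := by
    intro j; rw [hVbar]
    split_ifs
    · exact hv₁
    · positivity
  obtain ⟨e, he⟩ : ∃ e : ℕ → ℝ, ∀ j, e j =
      min ((((j : ℝ) + 1) * ((j : ℝ) + 2))⁻¹ * |H₀| / (2 * C * (‖curlCLM‖ + 1) * Vbar j ^ (1 / 3 : ℝ)))
        (((((j : ℝ) + 1) * ((j : ℝ) + 2))⁻¹ * |H₀|) ^ 2 * (2 * (2 ^ j * A)) ^ (1 + 2 * ρ) /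
          (4 * C ^ 2 * (‖curlCLM‖ + 1) ^ 2 * ((c : ℝ) + 1) * Vbar j ^ (2 / 3 : ℝ))) := ⟨_, fun j => rfl⟩
  have he_pos : ∀ j, 0 < e j := by
    intro j
    rw [he]
    have h1 : 0 < Vbar j ^ (1 / 3 : ℝ) := Real.rpow_pos_of_pos (hVbar_pos j) _
    have h2 : 0 < Vbar j ^ (2 / 3 : ℝ) := Real.rpow_pos_of_pos (hVbar_pos j) _
    have h3 : 0 < (2 * (2 ^ j * A)) ^ (1 + 2 * ρ) := Real.rpow_pos_of_pos (by positivity) _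
    exact lt_min (by positivity) (by positivity)
  obtain ⟨M, hM⟩ : ∃ M : ℕ → ℝ, ∀ j, M j = (c : ℝ) * (2 * (2 ^ j * A)) ^ (1 - ρ) := ⟨_, fun j => rfl⟩
  have hM_nonneg : ∀ j, 0 ≤ M j := fun j => by rw [hM]; exact mul_nonneg hc0 (Real.rpow_nonneg (by positivity) _)
  obtain ⟨G, hG⟩ : ∃ G : ℕ → ℝ → ℝ≥0∞, ∀ j σ, G j σ =
      ∫⁻ x in ball (0 : EuclideanSpace ℝ (Fin 3)) (2 * (2 ^ j * A)), ‖fderiv ℝ (u σ) x‖ₑ ^ 2 := ⟨_, fun j σ => rfl⟩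
  have hrad : ∀ j : ℕ, (2 : ℝ) ^ (j + 1) * A = 2 * (2 ^ j * A) := fun j => by rw [pow_succ]; ring
  have h2j : ∀ j : ℕ, (1 : ℝ) ≤ 2 ^ j := fun j => one_le_pow₀ one_le_two
  -- the window
  obtain ⟨W, hW⟩ : ∃ W : Set ℝ, W = Ioo (t₀ - A ^ 2) t₀ := ⟨_, rfl⟩
  have hWm : MeasurableSet W := by rw [hW]; exact measurableSet_Ioo
  have hW0 : W ⊆ Iio 0 := fun σ hσ => by rw [hW] at hσ; exact lt_trans hσ.2 ht₀
  have hWIcc : W ⊆ Icc (t₀ - A ^ 2) t₀ := by rw [hW]; exact Ioo_subset_Icc_self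
  have hsqA : ∀ j : ℕ, A ^ 2 ≤ (2 ^ j * A) ^ 2 := fun j => by
    rw [mul_pow]
    have h1 : (1 : ℝ) ≤ (2 ^ j) ^ 2 := one_le_pow₀ (h2j j)
    have h2 : 0 ≤ A ^ 2 := sq_nonneg A
    calc A ^ 2 = 1 * A ^ 2 := (one_mul _).symm
      _ ≤ (2 ^ j) ^ 2 * A ^ 2 := mul_le_mul_of_nonneg_right h1 h2
  have hWwin : ∀ j : ℕ, W ⊆ Ioo (-(2 * (2 ^ j * A)) ^ 2) 0 := by
    intro j σ hσ
    rw [hW] at hσ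
    refine ⟨?_, lt_trans hσ.2 ht₀⟩
    have h1 : (2 * (2 ^ j * A)) ^ 2 = 4 * (2 ^ j * A) ^ 2 := by ring
    have h2 := hsqA j
    have h3 : t₀ - A ^ 2 < σ := hσ.1
    have h4 := sq_nonneg A
    rw [h1]
    linarith only [h2, h3, h4, hAt]
  -- ### measurability and the `E`-gauge budget of `G j`
  have hD_cont : ContinuousOn (uncurry fun t x => fderiv ℝ (u t) x) (Iio (0 : ℝ) ×ˢ (univ : Set (EuclideanSpace ℝ (Fin 3)))) :=
    (hcl.smooth_velocity.fderiv_slice isOpen_Iio.uniqueDiffOn).continuousOn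
  have hGi : ∀ (a : ℝ) (I : Set ℝ), I ⊆ Iio 0 → MeasurableSet I →
      AEMeasurable (uncurry fun (σ : ℝ) (x : EuclideanSpace ℝ (Fin 3)) => ‖fderiv ℝ (u σ) x‖ₑ ^ 2)
        ((volume.restrict I).prod (volume.restrict (ball (0 : EuclideanSpace ℝ (Fin 3)) a))) := by
    intro a I hI0 hIm
    rw [Measure.prod_restrict, ← Measure.volume_eq_prod]
    have hDm : AEMeasurable (uncurry fun t x => fderiv ℝ (u t) x)
        (volume.restrict (I ×ˢ ball (0 : EuclideanSpace ℝ (Fin 3)) a)) :=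
      (hD_cont.mono (prod_mono hI0 (subset_univ _))).aemeasurable (hIm.prod measurableSet_ball)
    exact hDm.enorm.pow_const _
  have hGmeas : ∀ j, j < N + 1 → AEMeasurable (G j) (volume.restrict W) := fun j _ => by
    rw [show G j = fun σ => ∫⁻ x in ball (0 : EuclideanSpace ℝ (Fin 3)) (2 * (2 ^ j * A)), ‖fderiv ℝ (u σ) x‖ₑ ^ 2 from
      funext (hG j)]
    exact (hGi _ W hW0 hWm).lintegral_prod_right'
  have hGint : ∀ j, j < N + 1 → ∫⁻ σ in W, G j σ ≤ ENNReal.ofReal (M j) := by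
    intro j _
    have ha : (0 : ℝ) < 2 * (2 ^ j * A) := by positivity
    have hpt : ∀ z : ℝ × EuclideanSpace ℝ (Fin 3), ‖fderiv ℝ (u z.1) z.2‖ₑ ^ 2 ≤
        ENNReal.ofReal (frobeniusNormSq (fderiv ℝ (u z.1) z.2)) := by
      intro z
      rw [← ofReal_norm, ← ENNReal.ofReal_pow (norm_nonneg _)]
      exact ENNReal.ofReal_le_ofReal (sq_opNorm_le_frobeniusNormSq _)
    calc ∫⁻ σ in W, G j σ ≤ ∫⁻ σ in Ioo (-(2 * (2 ^ j * A)) ^ 2) 0, G j σ := lintegral_mono_set (hWwin j)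
      _ = ∫⁻ σ in Ioo (-(2 * (2 ^ j * A)) ^ 2) 0, ∫⁻ x in ball (0 : EuclideanSpace ℝ (Fin 3)) (2 * (2 ^ j * A)),
            ‖fderiv ℝ (u σ) x‖ₑ ^ 2 := lintegral_congr fun σ => hG j σ
      _ = ∫⁻ z in Ioo (-(2 * (2 ^ j * A)) ^ 2) 0 ×ˢ ball (0 : EuclideanSpace ℝ (Fin 3)) (2 * (2 ^ j * A)),
            ‖fderiv ℝ (u z.1) z.2‖ₑ ^ 2 := by
          rw [lintegral_lintegral (hGi _ _ Ioo_subset_Iio_self measurableSet_Ioo), Measure.prod_restrict,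
            ← Measure.volume_eq_prod]
      _ ≤ ∫⁻ z in Ioo (-(2 * (2 ^ j * A)) ^ 2) 0 ×ˢ ball (0 : EuclideanSpace ℝ (Fin 3)) (2 * (2 ^ j * A)),
            ENNReal.ofReal (frobeniusNormSq (fderiv ℝ (u z.1) z.2)) := lintegral_mono fun z => hpt z
      _ ≤ ENNReal.ofReal (M j) := by rw [hM]; exact hEwin _ ha
  -- ### the per-time step: some region hosts and pays
  have hcover : ∀ σ ∈ W, ∃ j, j < N + 1 ∧ ENNReal.ofReal (e j) ≤ G j σ := by
    intro σ hσW
    have hσI : σ ∈ Icc (t₀ - A ^ 2) t₀ := hWIcc hσW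
    have hσ0 : σ < 0 := hW0 hσW
    -- the helicity density and its shell sums
    have hvc : Continuous (u σ) := (hcl.contDiff_velocity hσ0).continuous
    have hKc : Continuous (curl (u σ)) := by
      rw [curl_eq_curlCLM_comp]
      exact curlCLM.continuous.comp ((hcl.contDiff_velocity hσ0).continuous_fderiv (by simp))
    obtain ⟨f, hf⟩ : ∃ f : EuclideanSpace ℝ (Fin 3) → ℝ, f = fun x => χ' σ x * ⟪u σ x, curl (u σ) x⟫ := ⟨_, rfl⟩
    have hfc : Continuous f := by rw [hf]; exact (hχ'c σ hσI).mul (hvc.inner hKc)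
    have hfzero : ∀ x, x ∉ ball (0 : EuclideanSpace ℝ (Fin 3)) (2 ^ (N + 1) * A) → f x = 0 := by
      intro x hx
      have : χ' σ x = 0 := by
        by_contra h
        exact hx (ball_subset_ball hJball (hXball σ hσI (hχ'supp σ hσI x h)))
      rw [hf]; simp only [this, zero_mul]
    have hsum : ∑ j ∈ Finset.range (N + 1),
        ∫ x in ball (0 : EuclideanSpace ℝ (Fin 3)) (2 ^ (j + 1) * A) ∩ {x | j ≠ 0 → 2 ^ j * A ≤ ‖x‖}, f x = H₀ := by
      rw [sum_integral_shell hA0.le (Nat.succ_pos N) (integrableOn_ball_of_continuous hfc _),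
        setIntegral_eq_integral_of_forall_compl_eq_zero fun x hx => hfzero x hx, hf]
      exact hhel σ hσI
    obtain ⟨j, hjN, hhost⟩ := exists_hosting (Nat.succ_pos N) _ hsum
    refine ⟨j, hjN, ?_⟩
    -- the hosting weight and its far label set
    obtain ⟨S, hS⟩ : ∃ S : Set (EuclideanSpace ℝ (Fin 3)), S = {x | j ≠ 0 → 2 ^ j * A ≤ ‖x‖} := ⟨_, rfl⟩
    have hSm : MeasurableSet S := by
      by_cases hj : j = 0
      · have : S = univ := by ext x; simp [hS, hj]
        rw [this]; exact MeasurableSet.univ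
      · have : S = {x | 2 ^ j * A ≤ ‖x‖} := by ext x; simp [hS, hj]
        rw [this]; exact measurableSet_le measurable_const measurable_norm
    have hwfm : Measurable (S.indicator (χ' σ)) := (hχ'c σ hσI).measurable.indicator hSm
    have hwf1 : ∀ x, |S.indicator (χ' σ) x| ≤ 1 := by
      intro x
      by_cases hx : x ∈ S
      · rw [Set.indicator_of_mem hx]; exact hχ'1 σ hσI x
      · rw [Set.indicator_of_notMem hx]; simp
    have hXσc : Continuous (X σ) := hXc.comp (continuous_const.prodMk continuous_id)
    obtain ⟨E, hE⟩ : ∃ E : Set (EuclideanSpace ℝ (Fin 3)), E = {x | χ x ≠ 0} ∩ {y | j ≠ 0 → 2 ^ j * A ≤ ‖X σ y‖} :=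
      ⟨_, rfl⟩
    have hEm : MeasurableSet E := by
      rw [hE]
      refine hTm.inter ?_
      by_cases hj : j = 0
      · have : {y : EuclideanSpace ℝ (Fin 3) | j ≠ 0 → 2 ^ j * A ≤ ‖X σ y‖} = univ := by ext y; simp [hj]
        rw [this]; exact MeasurableSet.univ
      · have : {y : EuclideanSpace ℝ (Fin 3) | j ≠ 0 → 2 ^ j * A ≤ ‖X σ y‖} = {y | 2 ^ j * A ≤ ‖X σ y‖} := by
          ext y; simp [hj]
        rw [this]; exact measurableSet_le measurable_const hXσc.norm.measurable
    have hET : E ⊆ {x | χ x ≠ 0} := by rw [hE]; exact inter_subset_left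
    obtain ⟨hT'm, hT'vol⟩ := hXvol σ hσI E hET hEm
    have hEfin : volume E < ⊤ := (measure_mono hET).trans_lt hTfin
    have hT'fin : volume (X σ '' E) < ⊤ := by rw [hT'vol]; exact hEfin
    have hwfT' : ∀ x, x ∉ X σ '' E → S.indicator (χ' σ) x = 0 := by
      intro x hx
      by_contra h
      have hx' := Set.indicator_apply_ne_zero.1 h
      obtain ⟨hxS, hxsupp⟩ := hx'
      rw [Function.mem_support] at hxsupp
      obtain ⟨y, hyT, rfl⟩ := hχ'supp σ hσI _ hxsupp
      rw [hS] at hxS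
      exact hx ⟨y, by rw [hE]; exact ⟨hyT, hxS⟩, rfl⟩
    -- the volume of the far label set
    have hT'V : (volume (X σ '' E)).toReal ≤ Vbar j := by
      rw [hT'vol, hVbar]
      split_ifs with hj
      · have := ENNReal.toReal_mono hTfin.ne (measure_mono hET)
        linarith only [this]
      · have hj1 : 1 ≤ j := Nat.one_le_iff_ne_zero.2 hj
        have h2j' : (2 : ℝ) ≤ 2 ^ j := by
          calc (2 : ℝ) = 2 ^ 1 := (pow_one _).symm
            _ ≤ 2 ^ j := pow_le_pow_right₀ one_le_two hj1
        have hRf : 2 * R ≤ 2 ^ j * A :=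
          calc 2 * R ≤ 2 * A := by linarith only [hAR]
            _ ≤ 2 ^ j * A := mul_le_mul_of_nonneg_right h2j' hA0.le
        have hRft : -(2 ^ j * A) ^ 2 < t₀ - A ^ 2 := by
          have h1 : 4 * A ^ 2 ≤ (2 ^ j * A) ^ 2 := by
            rw [mul_pow]
            have : (4 : ℝ) ≤ (2 ^ j) ^ 2 := by nlinarith only [h2j']
            exact mul_le_mul_of_nonneg_right this (sq_nonneg A)
          have h2 : 0 < A ^ 2 := by positivity
          linarith only [h1, h2, hAt]
        have hfarE := hfar (2 ^ j * A) hRf hRft σ hσI E hET hEm fun y hy => by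
          rw [hE] at hy; exact hy.2 hj
        exact le_farVolumeBar ENNReal.toReal_nonneg hA1 hAR hj1 (by linarith [hσI.1]) (Real.sqrt_nonneg _)
          (by linarith) hCV.le hρ.le hfarE
    -- hosting, in the form of the step lemma
    have hhost' : (((j : ℝ) + 1) * ((j : ℝ) + 2))⁻¹ * |H₀| ≤
        |∫ x in ball (0 : EuclideanSpace ℝ (Fin 3)) (2 * (2 ^ j * A)), S.indicator (χ' σ) x * ⟪u σ x, curl (u σ) x⟫| := by
      have heq : ∫ x in ball (0 : EuclideanSpace ℝ (Fin 3)) (2 * (2 ^ j * A)), S.indicator (χ' σ) x * ⟪u σ x, curl (u σ) x⟫ =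
          ∫ x in ball (0 : EuclideanSpace ℝ (Fin 3)) (2 ^ (j + 1) * A) ∩ {x | j ≠ 0 → 2 ^ j * A ≤ ‖x‖}, f x := by
        have hpt : (fun x => S.indicator (χ' σ) x * ⟪u σ x, curl (u σ) x⟫) = S.indicator f := by
          funext x
          by_cases hx : x ∈ S
          · rw [Set.indicator_of_mem hx, Set.indicator_of_mem hx, hf]
          · rw [Set.indicator_of_notMem hx, Set.indicator_of_notMem hx, zero_mul]
        rw [hpt, integral_indicator hSm, Measure.restrict_restrict hSm, inter_comm, hrad j, hS]
      rw [heq, mul_comm]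
      exact hhost
    have ha : (0 : ℝ) < 2 * (2 ^ j * A) := by positivity
    have hq := ofReal_quantum_le_lintegral hcl hA hC hF ha (hWwin j hσW) hwfm hwf1 hT'm hT'fin hwfT' (hVbar_pos j) hT'V
      (by positivity : (0 : ℝ) < (((j : ℝ) + 1) * ((j : ℝ) + 2))⁻¹) hH hhost'
    have hej : e j = min ((((j : ℝ) + 1) * ((j : ℝ) + 2))⁻¹ * |H₀| / (2 * C * (‖curlCLM‖ + 1) * Vbar j ^ (1 / 3 : ℝ)))
        (((((j : ℝ) + 1) * ((j : ℝ) + 2))⁻¹ * |H₀|) ^ 2 * (2 * (2 ^ j * A)) ^ (1 + 2 * ρ) /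
          (4 * C ^ 2 * (‖curlCLM‖ + 1) ^ 2 * ((c : ℝ) + 1) * Vbar j ^ (2 / 3 : ℝ))) := he j
    rw [hej, hG]
    exact hq
  -- ### the window is short: `A² ≤ Σ_j M_j / e_j`
  have hshort := measureReal_le_sum_of_cover hWm hGmeas (fun j _ => he_pos j) (fun j _ => hM_nonneg j) hGint hcover
  have hvolW : (volume W).toReal = A ^ 2 := by
    rw [hW, Real.volume_Ioo, ENNReal.toReal_ofReal (by linarith only [sq_nonneg A])]; ring
  rw [hvolW, Finset.sum_range_succ'] at hshort
  -- ### the exponent count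
  have hcore : M 0 / e 0 ≤ 8 * C * (‖curlCLM‖ + 1) * c * ((volume ({x | χ x ≠ 0} : Set (EuclideanSpace ℝ (Fin 3)))).toReal + 1) ^ (1 / 3 : ℝ) / |H₀| *
        A ^ (1 - ρ) +
      16 * C ^ 2 * (‖curlCLM‖ + 1) ^ 2 * c * ((c : ℝ) + 1) *
        ((volume ({x | χ x ≠ 0} : Set (EuclideanSpace ℝ (Fin 3)))).toReal + 1) ^ (2 / 3 : ℝ) / |H₀| ^ 2 := by
    have h := coreTerm_le (ρ := ρ) (A := A) hC hκ hv₁ hc0 hc₁ hH hA1 hρ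
    have hV0 : Vbar 0 = (volume ({x | χ x ≠ 0} : Set (EuclideanSpace ℝ (Fin 3)))).toReal + 1 := by rw [hVbar, if_pos rfl]
    have hw0 : (((0 : ℕ) : ℝ) + 1) * (((0 : ℕ) : ℝ) + 2) = 2 := by norm_num
    have e1 : M 0 = (c : ℝ) * (2 * A) ^ (1 - ρ) := by
      rw [hM, pow_zero, one_mul]
    have e2 : e 0 = min ((2 : ℝ)⁻¹ * |H₀| / (2 * C * (‖curlCLM‖ + 1) *
          ((volume ({x | χ x ≠ 0} : Set (EuclideanSpace ℝ (Fin 3)))).toReal + 1) ^ (1 / 3 : ℝ)))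
        (((2 : ℝ)⁻¹ * |H₀|) ^ 2 * (2 * A) ^ (1 + 2 * ρ) /
          (4 * C ^ 2 * (‖curlCLM‖ + 1) ^ 2 * ((c : ℝ) + 1) *
            ((volume ({x | χ x ≠ 0} : Set (EuclideanSpace ℝ (Fin 3)))).toReal + 1) ^ (2 / 3 : ℝ))) := by
      rw [he, hV0, hw0, pow_zero, one_mul]
    rw [e1, e2]; exact h
  have hshell : ∀ i ∈ Finset.range N, M (i + 1) / e (i + 1) ≤
      (64 * C * (‖curlCLM‖ + 1) * CV ^ 2 * (Real.sqrt c + 1) ^ 2 * c / |H₀| *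
            ((((i + 1 : ℕ) : ℝ) + 1) * ((((i + 1 : ℕ) : ℝ)) + 2)) * ((2 : ℝ) ^ (-2 * ρ)) ^ (i + 1) +
          1024 * C ^ 2 * (‖curlCLM‖ + 1) ^ 2 * CV ^ 4 * (Real.sqrt c + 1) ^ 4 * c * ((c : ℝ) + 1) / |H₀| ^ 2 *
            ((((i + 1 : ℕ) : ℝ) + 1) * (((i + 1 : ℕ) : ℝ) + 2)) ^ 2 * ((2 : ℝ) ^ (-2 - 2 * ρ)) ^ (i + 1)) *
        A ^ (2 - 2 * ρ) := by
    intro i _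
    have h := shellTerm_le (ρ := ρ) (A := A) (j := i + 1) hC hκ hCV hs₁ hc0 hc₁ hH hA1 hρ (by omega)
    have hVi : Vbar (i + 1) = (4 * CV * (Real.sqrt c + 1) * (2 ^ (i + 1) * A) ^ ((1 - ρ) / 2) * (2 ^ (i + 1))⁻¹) ^ 6 := by
      rw [hVbar, if_neg (Nat.succ_ne_zero i)]
    have e1 : M (i + 1) = (c : ℝ) * (2 * (2 ^ (i + 1) * A)) ^ (1 - ρ) := hM (i + 1)
    have e2 : e (i + 1) = min ((((((i + 1 : ℕ) : ℝ)) + 1) * ((((i + 1 : ℕ) : ℝ)) + 2))⁻¹ * |H₀| /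
          (2 * C * (‖curlCLM‖ + 1) * ((4 * CV * (Real.sqrt c + 1) * (2 ^ (i + 1) * A) ^ ((1 - ρ) / 2) * (2 ^ (i + 1))⁻¹) ^ 6) ^ (1 / 3 : ℝ)))
        (((((((i + 1 : ℕ) : ℝ)) + 1) * ((((i + 1 : ℕ) : ℝ)) + 2))⁻¹ * |H₀|) ^ 2 * (2 * (2 ^ (i + 1) * A)) ^ (1 + 2 * ρ) /
          (4 * C ^ 2 * (‖curlCLM‖ + 1) ^ 2 * ((c : ℝ) + 1) *
            ((4 * CV * (Real.sqrt c + 1) * (2 ^ (i + 1) * A) ^ ((1 - ρ) / 2) * (2 ^ (i + 1))⁻¹) ^ 6) ^ (2 / 3 : ℝ))) := by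
      rw [he, hVi]
    rw [e1, e2]; exact h
  -- sum of the shell costs against the full series
  obtain ⟨g, hg⟩ : ∃ g : ℕ → ℝ, ∀ j, g j =
    64 * C * (‖curlCLM‖ + 1) * CV ^ 2 * (Real.sqrt c + 1) ^ 2 * c / |H₀| * (((j : ℝ) + 1) * ((j : ℝ) + 2)) * ((2 : ℝ) ^ (-2 * ρ)) ^ j +
      1024 * C ^ 2 * (‖curlCLM‖ + 1) ^ 2 * CV ^ 4 * (Real.sqrt c + 1) ^ 4 * c * ((c : ℝ) + 1) / |H₀| ^ 2 *
        (((j : ℝ) + 1) * ((j : ℝ) + 2)) ^ 2 * ((2 : ℝ) ^ (-2 - 2 * ρ)) ^ j := ⟨_, fun j => rfl⟩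
  have hg0 : ∀ j, 0 ≤ g j := fun j => by rw [hg]; positivity
  have hgeq : ∀ j : ℕ, 64 * C * (‖curlCLM‖ + 1) * CV ^ 2 * (Real.sqrt c + 1) ^ 2 * c / |H₀| *
        (((j : ℝ) + 1) * ((j : ℝ) + 2) * ((2 : ℝ) ^ (-2 * ρ)) ^ j) +
      1024 * C ^ 2 * (‖curlCLM‖ + 1) ^ 2 * CV ^ 4 * (Real.sqrt c + 1) ^ 4 * c * ((c : ℝ) + 1) / |H₀| ^ 2 *
        ((((j : ℝ) + 1) * ((j : ℝ) + 2)) ^ 2 * ((2 : ℝ) ^ (-2 - 2 * ρ)) ^ j) = g j := fun j => by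
    rw [hg]; ring
  have hgsum' := (hS1.mul_left (64 * C * (‖curlCLM‖ + 1) * CV ^ 2 * (Real.sqrt c + 1) ^ 2 * c / |H₀|)).add
    (hS2.mul_left (1024 * C ^ 2 * (‖curlCLM‖ + 1) ^ 2 * CV ^ 4 * (Real.sqrt c + 1) ^ 4 * c * ((c : ℝ) + 1) / |H₀| ^ 2))
  have hgsum : Summable g := hgsum'.congr hgeq
  have hgtsum : ∑' j, g j = 64 * C * (‖curlCLM‖ + 1) * CV ^ 2 * (Real.sqrt c + 1) ^ 2 * c / |H₀| *
        ∑' j : ℕ, ((j : ℝ) + 1) * ((j : ℝ) + 2) * ((2 : ℝ) ^ (-2 * ρ)) ^ j +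
      1024 * C ^ 2 * (‖curlCLM‖ + 1) ^ 2 * CV ^ 4 * (Real.sqrt c + 1) ^ 4 * c * ((c : ℝ) + 1) / |H₀| ^ 2 *
        ∑' j : ℕ, (((j : ℝ) + 1) * ((j : ℝ) + 2)) ^ 2 * ((2 : ℝ) ^ (-2 - 2 * ρ)) ^ j := by
    rw [← tsum_congr hgeq, (hS1.mul_left _).tsum_add (hS2.mul_left _), tsum_mul_left, tsum_mul_left]
  have hshellsum : ∑ i ∈ Finset.range N, M (i + 1) / e (i + 1) ≤ (∑' j, g j) * A ^ (2 - 2 * ρ) := by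
    have hA22 : 0 ≤ A ^ (2 - 2 * ρ) := Real.rpow_nonneg hA0.le _
    calc ∑ i ∈ Finset.range N, M (i + 1) / e (i + 1) ≤ ∑ i ∈ Finset.range N, g (i + 1) * A ^ (2 - 2 * ρ) :=
          Finset.sum_le_sum fun i hi => by rw [hg]; exact hshell i hi
      _ = (∑ i ∈ Finset.range N, g (i + 1)) * A ^ (2 - 2 * ρ) := by rw [Finset.sum_mul]
      _ ≤ (∑ j ∈ Finset.range (N + 1), g j) * A ^ (2 - 2 * ρ) := by
          refine mul_le_mul_of_nonneg_right ?_ hA22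
          rw [Finset.sum_range_succ']
          linarith [hg0 0]
      _ ≤ (∑' j, g j) * A ^ (2 - 2 * ρ) :=
          mul_le_mul_of_nonneg_right (hgsum.sum_le_tsum _ fun j _ => hg0 j) hA22
  rw [hgtsum] at hshellsum
  have hsum_nonneg : 0 ≤ ∑' j : ℕ, g j := tsum_nonneg hg0
  linarith only [hshort, hcore, hshellsum, hAlt]

end Summit.NavierStokesRegularity.NavierStokesRegularity.Theorems.PowerGaugeEulerLiouville.ChiralAnchor

end
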